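import Literature.Analysis.FluidPDE.AxisymmetricNoSwirlAprioriProofs
import Literature.MathematicalPhysics.KineticTheory.HardSphereEuler
import HarnessLib

/-!
# Grönwall for a monotone function under an integral inequality (stub `stub_monotoneGronwall`, line
# `IdeatorTwoSketch`, crux `ClampedCurrentsDock`, stmt-AtomisticToContinuum-14680)

Helper file (`--supports stmt-AtomisticToContinuum-14680`) proving the registered stub
`stub_monotoneGronwall : MonotoneIntegralGronwall` of the lead's skeleton
(`Cruxes/ClampedCurrentsDock/Lines/IdeatorTwoSketch.lean`): the endpoint of the MULTI-WINDOW relative-entropy ledger.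
Each additive term of the entropy production is priced on its own window system; with `S(t′) = sup_{s ≤ t′} H_N(s)`
the left Riemann sums `Σ_W h_W H(τ_W)` of the nondecreasing `S` are at most `∫ S`, so the ledger closes in the form
`S(t′) ≤ C₀ + (m/β)∫₀^{t′} S`, i.e. exactly the hypothesis below. The proof is the tree's measurability-free
integral Grönwall lemma (`Literature.Analysis.FluidPDE.gronwall_const_of_integral_le`, Robinson–Rodrigo–Sadowski 2016
Lemma A.25) applied to a monotone (hence bounded and integrable) function.
-/

noncomputable section

namespace Summit.AtomisticToContinuum.HydrodynamicLimit.Theorems.ClampedCurrentsDockGronwall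

open MeasureTheory Filter Set Topology
open Literature.MathematicalPhysics.KineticTheory Literature.Analysis.FluidPDE Literature.Analysis.FunctionSpaces

/-- **S13 — Gronwall for a monotone function under an integral inequality (generic real analysis; worker-sized).**
If `S` is nondecreasing on `[0, T]`, `S 0 ≥ 0`, and `S t ≤ C + K ∫₀ᵗ S` for all `t ∈ [0,T]` (`K ≥ 0`), then
`S T ≤ C e^{KT}`. This is the form the MULTI-WINDOW ledger ends in: with `S(t′) = sup_{s ≤ t′} H_N(s)`, every
additive term of the entropy production priced on ITS OWN window system contributes `(1/β)Σ_W h_W H(τ_W) ≤ (1/β)∫S`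
(left Riemann sums of a nondecreasing function), so `S(t′) ≤ C₀ + (m/β)∫₀^{t′} S` and `S(t) ≤ C₀e^{mt/β}` — no common
window length across terms or net points is needed (answer to the window-quantifier mismatch, disprover nudge J1). -/
def MonotoneIntegralGronwall : Prop :=
  ∀ (S : ℝ → ℝ) (C K T : ℝ), 0 ≤ K → 0 ≤ T → MonotoneOn S (Set.Icc 0 T) → 0 ≤ S 0 →
    (∀ t ∈ Set.Icc 0 T, S t ≤ C + K * ∫ s in (0 : ℝ)..t, S s) → S T ≤ C * Real.exp (K * T)

/-- **STUB S13 `stub_monotoneGronwall`** of line `IdeatorTwoSketch` (crux `ClampedCurrentsDock`, stmt-14680). -/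
theorem stub_monotoneGronwall : MonotoneIntegralGronwall := by
  intro S C K T hK hT hmono hS0 hineq
  have h0mem : (0 : ℝ) ∈ Icc 0 T := ⟨le_rfl, hT⟩
  -- `C ≥ S 0 ≥ 0` from the inequality at `t = 0`
  have hC : S 0 ≤ C := by
    have h := hineq 0 h0mem
    simp only [intervalIntegral.integral_same, mul_zero, add_zero] at h
    exact h
  have hC0 : 0 ≤ C := hS0.trans hC
  rcases hT.eq_or_lt with hT0 | hTpos
  · -- `T = 0`
    subst hT0
    simpa using hC
  -- the monotone function is nonnegative, bounded by `S T` and integrable on `[0, T]`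
  have hY0 : ∀ τ ∈ Icc 0 T, 0 ≤ S τ := fun τ hτ => hS0.trans (hmono h0mem hτ hτ.1)
  have hYb : ∀ τ ∈ Icc 0 T, S τ ≤ S T := fun τ hτ => hmono hτ ⟨hT, le_rfl⟩ hτ.2
  have hYi : IntegrableOn S (Icc 0 T) := hmono.integrableOn_isCompact isCompact_Icc
  have hineq' : ∀ τ ∈ Icc 0 T, S τ ≤ C + 2 * (K / 2) * ∫ s in (0 : ℝ)..τ, S s := by
    intro τ hτ
    have h := hineq τ hτ
    have e : 2 * (K / 2) = K := by ring
    rwa [e]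
  have h := gronwall_const_of_integral_le hTpos hC0 (by positivity : 0 ≤ K / 2) hY0 hYb hYi hineq' T
    ⟨hT, le_rfl⟩
  have e : 2 * (K / 2) * T = K * T := by ring
  rwa [e] at h

end Summit.AtomisticToContinuum.HydrodynamicLimit.Theorems.ClampedCurrentsDockGronwall

end
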